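/-
Copyright: the b2b-balaban cell (near-miss cell 7), T⁴-continuum fan-out; row NE7b ROUND-2 swarm, seat
t4-ne7b-formalise-leaf-02 gen 4 (row S6g′ instance sub-piece «INST-SUP» of `t4/b2b-balaban-t4-ne7b-p1/LEAVES-NE7b.md`,
leaf-05 gen 2's `INSTANCE-RECIPE.md` §1 + §3).
Released under the licence of the surrounding project.
-/
import Summits.QuantumFields.BalabanUV.T4Continuum.Support.HistoryJoinsEntropyBudget
import Summits.QuantumFields.BalabanUV.T4Continuum.Support.HistoryJoinsRadius

/-!
# History joins, suprema: the END's LOCAL LAWS BY SUPREMA and the MASS-TOTAL INPUT `hMS` in the consumer's shape (row S6g′)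

Summits-side support leaf of the T⁴-continuum cell (rung (B)+1 on a FINITE torus only; NOT infinite volume, NOT the
mass gap, NOT the Clay statement; NOT a proof of the spine estimate NE7b).  Row NE7b, route «COUNT»; row S6g′, a
GENERIC supplier for the instance of the binding's END (`HistoryJoinsEntropyBudget.card_S_le_budgetE` ∕ leaf-05 gen 2's
`HistoryJoinsEnd.card_S_le_exp_pow`).  [folklore] finite bookkeeping and real arithmetic over the lineage's own carriers
(`HistoryJoinsAdm.Sany`, `HistoryJoinsBudget.MS`∕`MρP`, `HistoryZoneMassTotal.umass`); nothing is quoted from print,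
nothing printed is asserted, no `[cite:]` tag, no `Prop` fact of Bałaban's.

WHAT.  The END counts the canonically admissible junk placements `S zone ρ c₀ st G z` against a budget
`budgetE st M ext NZ G` under three LOCAL LAWS — `hcard : p ∈ Sany Z → #zone t Z p ≤ M t Z`,
`hloc : p ∈ Sany Z → u ∈ zone t Z p → near u t (root cell) (rootStep Z) (ext t Z)`, `hNZ : #{y | near u t y s r} ≤ NZ r t s` —
and CLASS-LINEAR INPUTS on `MS st M G`, `MρP st ext Mρ G`, `ENT st G`.  This file makes the first two local laws
TAUTOLOGICAL by DEFINING the majorants as suprema over the finite admissible set (`Addr D → γ` is a `Fintype`):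
* §1 **`Msup zone ρ c₀ st t Z := (Sany … Z).sup (#zone t Z ·)`** — `card_zone_le_Msup` IS `hcard`; `Msup_le_of_forall`
  (a real bound valid for every admissible placement bounds the supremum);
* §2 **`extsup zone ρ c₀ st δ t Z`** := the supremum over `p ∈ Sany Z`, `u ∈ zone t Z p` of a displayed WITNESS RADIUS
  `δ u t y s : ℝ` at the root cell (clipped at `0`, valued in `ℝ≥0`) — for any nearness relation `near` monotone in the
  radius, `hloc` at `ext := extsup` (`near_extsup`) follows from the READING fact `hnearW` «every admissibly placed zone
  block is near the root cell at its own witness radius» (`le_rfl` for relations of distance form `dist ≤ r`; the side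
  conditions «`t ≤ K`, scale-`s` root cell, block in range» for the torus touch relation); `extsup_nonneg` is free (the
  sign asked by `HistoryJoinsRadius.MρP_le_exp_bsum`); `extsup_le_of_forall`;
* §3 **`card_S_le_budgetE_sup`**: `#S G z ≤ budgetE st Msup extsup NZ G` with ONLY the one-block root count `hNZ` left as
  a local law (the zone's block type `β` — `Fin d → ℕ` on the zone road — is infinite, and the torus count
  `HistoryMassPlacementTorus.card_touchT_le` is uniform in the block anyway, so `NZ` is not taken as a supremum); §3b the
  real-radius hull **`nearOfNat`** of an INTEGER-radius touch relation (`touchT n L K k t u y s`-type): monotone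
  (`nearOfNat_mono`), witnessed at `δ := k` (`nearOfNat_of_touch`), and its one-block count transfers from the integer
  count, **`card_nearOfNat_le`**: `#{y | nearOfNat touch u t y s r} ≤ N ⌊r⌋₊ t s`;
* §4 **`MS_le_of_law`** (`HistoryJoinsBudget.MS_eq_sum_joins` + `List.sum_le_sum`), **`MS_le_of_zmass`**, **`MS_le_bsum`**:
  under a CARDINALITY LAW DISPLAYED AT THE JOINS `∀ X ∈ joins, ∀ P ∈ tparts X, M (ftime X) P ≤ zmass sh θ WB WM (ftime X) P + γ′`
  and `Dated`∕`Chrono`, `MS ≤ umass∕(1−θ) + 2γ′·nmerges ≤ ((WB + WM)∕(1 − θ) + 2γ′)·Σ_births (fat + 1)` — the END's `hMS`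
  from row (a)-TOTAL (leaf-02 gen 3's `HistoryZoneMassTotal.sum_joins_tparts_zmass_add_le`), the `MS` twin of leaf-05
  gen 2's `HistoryJoinsRadius.MρP_le_exp_bsum`; and **`MS_sup_le_bsum`**: the same for `M := Msup` under the PER-PLACEMENT
  cardinality law at the joins `∀ X P, ∀ p ∈ Sany P, #zone (ftime X) P p ≤ zmass … + γ′` (row (a): leaf-04's
  `card_zone_le`∕`card_regZoneD_le_pieces` through the bridge `HistoryZoneMassBridge.hconn_of_cadm`);
* §5 **`MρP_sup_le_exp_bsum`**: `MρP_le_exp_bsum` at `ext := extsup`, its extent law discharged to the PER-PLACEMENT extent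
  law at the joins `∀ X P, ∀ p ∈ Sany P, ∀ u ∈ zone (ftime X) P p, δ u (ftime X) (root cell of p) (rootStep P) ≤ C₁·zmass … + c₁`.

So, for the instance, ALL geometry sits in two per-placement laws evaluated ONLY at (join, part) pairs — where rows
(a)∕(b)'s laws hold — plus the torus count, the reading fact `hnearW` and the sibling-entropy input `hENT` (row S6g′(f)); `hcard`∕`hloc` are gone.
§6 sanity: the distance form and a toy integer-radius relation meet §2∕§3b's hypotheses.

HONEST SCOPE.  Bookkeeping over OUR carriers; the per-placement laws, `Dated`∕`Chrono` and the constants' signs are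
DISPLAYED hypotheses with named suppliers; «realised placements are canonically admissible» is the H3 reading side;
`BirthShapeNodup` is NOT retired by this file; NE7b NOT proved; spine 0∕9.  HONEST DEPENDENCY (cell): continuum YM on
T⁴ ⇐ BetaPertH ∧ nine spine estimates (0/9 proved); BetaPertH ⇐ (D1) ∧ (D4) ∧ CAP+tail; G-an2-4 gates asym, D1 and
NE2/3/4.  This file changes none of it.
-/

open Finset
open Literature.MathematicalPhysics.QuantumFieldTheory.Balaban1983to89
open T4PersistenceDictionary T4PartnerMultiplicity T4BranchingRecordsGas
open Summit.QuantumFields.BalabanUV.T4Continuum.HistoryJoins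
open Summit.QuantumFields.BalabanUV.T4Continuum.HistoryJoinsAdm
open Summit.QuantumFields.BalabanUV.T4Continuum.HistoryJoinsTotal
open Summit.QuantumFields.BalabanUV.T4Continuum.HistoryJoinsBudget
open Summit.QuantumFields.BalabanUV.T4Continuum.HistoryJoinsEntropyBudget
open Summit.QuantumFields.BalabanUV.T4Continuum.HistoryJoinsRadius
open Summit.QuantumFields.BalabanUV.T4Continuum.ZoneTorus
open Summit.QuantumFields.BalabanUV.T4Continuum.ZoneSkeleton
open Summit.QuantumFields.BalabanUV.T4Continuum.HistoryZoneMassJoins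
open Summit.QuantumFields.BalabanUV.T4Continuum.HistoryZoneMassLaw
open Summit.QuantumFields.BalabanUV.T4Continuum.HistoryZoneMassTotal

namespace Summit.QuantumFields.BalabanUV.T4Continuum.HistoryJoinsSup

noncomputable section

open scoped Classical

variable {ε γ β R : Type*} [DecidableEq β] [LinearOrder R] [Fintype γ] {D : ℕ}
  (zone : ℕ → Gen ε → (Addr D → γ) → Finset β) (ρ : (Addr D → γ) → R) (c₀ : γ) (st : ε → ℕ)

/-! ## §1 The cardinality majorant by supremum -/

/-- **THE CARDINALITY MAJORANT BY SUPREMUM**: the largest zone cardinality at step `t` over all canonically admissible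
junk placements of `Z` (a finite set: `Addr D → γ` is a `Fintype`). [folklore] -/
def Msup (t : ℕ) (Z : Gen ε) : ℕ := (Sany zone ρ c₀ st Z).sup fun p => (zone t Z p).card

/-- **THE END's `hcard` IS A TAUTOLOGY for `M := Msup`.** [folklore] -/
theorem card_zone_le_Msup (t : ℕ) (Z : Gen ε) {p : Addr D → γ} (hp : p ∈ Sany zone ρ c₀ st Z) :
    (zone t Z p).card ≤ Msup zone ρ c₀ st t Z :=
  Finset.le_sup (f := fun p => (zone t Z p).card) hp

/-- a bound valid for every admissible placement bounds the supremum (natural numbers) [folklore] -/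
theorem Msup_le {t : ℕ} {Z : Gen ε} {m : ℕ} (h : ∀ p ∈ Sany zone ρ c₀ st Z, (zone t Z p).card ≤ m) :
    Msup zone ρ c₀ st t Z ≤ m :=
  Finset.sup_le h

/-- **A REAL BOUND VALID FOR EVERY ADMISSIBLE PLACEMENT BOUNDS THE SUPREMUM** (the bound nonnegative, for the empty
admissible set). [folklore] -/
theorem Msup_le_of_forall {t : ℕ} {Z : Gen ε} {x : ℝ} (hx : 0 ≤ x)
    (h : ∀ p ∈ Sany zone ρ c₀ st Z, ((zone t Z p).card : ℝ) ≤ x) : (Msup zone ρ c₀ st t Z : ℝ) ≤ x := by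
  rcases (Sany zone ρ c₀ st Z).eq_empty_or_nonempty with h0 | hne
  · simp only [Msup, h0, sup_empty, bot_eq_zero, Nat.cast_zero]
    exact hx
  · obtain ⟨p, hp, hmax⟩ := exists_mem_eq_sup _ hne fun p => (zone t Z p).card
    rw [Msup, hmax]
    exact h p hp

/-! ## §2 The root-locality radius by supremum -/

variable (δ : β → ℕ → γ → ℕ → ℝ)

/-- **THE ROOT-LOCALITY RADIUS BY SUPREMUM**: the largest witness radius `δ u t (root cell) (rootStep Z)` (clipped at `0`)
over all canonically admissible junk placements `p` of `Z` and all blocks `u` of the zone `zone t Z p`; the root cell of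
`p` is `evalA c₀ p (rootAddr Z)`. [folklore] -/
def extsup (t : ℕ) (Z : Gen ε) : ℝ :=
  (((Sany zone ρ c₀ st Z).sup fun p => (zone t Z p).sup fun u =>
      (δ u t (evalA c₀ p (rootAddr Z)) Z.rootStep).toNNReal : NNReal) : ℝ)

/-- **THE RADIUS IS NONNEGATIVE** (the sign `HistoryJoinsRadius.MρP_le_exp_bsum` asks of `ext`). [folklore] -/
theorem extsup_nonneg (t : ℕ) (Z : Gen ε) : 0 ≤ extsup zone ρ c₀ st δ t Z := NNReal.coe_nonneg _

/-- every witness radius of an admissibly placed zone block is below the supremum [folklore] -/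
theorem le_extsup {t : ℕ} {Z : Gen ε} {p : Addr D → γ} {u : β} (hp : p ∈ Sany zone ρ c₀ st Z) (hu : u ∈ zone t Z p) :
    δ u t (evalA c₀ p (rootAddr Z)) Z.rootStep ≤ extsup zone ρ c₀ st δ t Z := by
  refine (Real.le_coe_toNNReal _).trans ?_
  unfold extsup
  have h1 : (δ u t (evalA c₀ p (rootAddr Z)) Z.rootStep).toNNReal ≤
      (zone t Z p).sup fun u => (δ u t (evalA c₀ p (rootAddr Z)) Z.rootStep).toNNReal :=
    Finset.le_sup (f := fun u => (δ u t (evalA c₀ p (rootAddr Z)) Z.rootStep).toNNReal) hu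
  have h2 : ((zone t Z p).sup fun u => (δ u t (evalA c₀ p (rootAddr Z)) Z.rootStep).toNNReal) ≤
      (Sany zone ρ c₀ st Z).sup fun p => (zone t Z p).sup fun u =>
        (δ u t (evalA c₀ p (rootAddr Z)) Z.rootStep).toNNReal :=
    Finset.le_sup (f := fun p => (zone t Z p).sup fun u => (δ u t (evalA c₀ p (rootAddr Z)) Z.rootStep).toNNReal) hp
  exact_mod_cast h1.trans h2

/-- **A NONNEGATIVE REAL BOUND VALID FOR EVERY ADMISSIBLY PLACED ZONE BLOCK BOUNDS THE SUPREMUM.** [folklore] -/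
theorem extsup_le_of_forall {t : ℕ} {Z : Gen ε} {x : ℝ} (hx : 0 ≤ x)
    (h : ∀ p ∈ Sany zone ρ c₀ st Z, ∀ u ∈ zone t Z p, δ u t (evalA c₀ p (rootAddr Z)) Z.rootStep ≤ x) :
    extsup zone ρ c₀ st δ t Z ≤ x := by
  unfold extsup
  rw [← Real.coe_toNNReal x hx]
  exact NNReal.coe_le_coe.2
    (Finset.sup_le fun p hp => Finset.sup_le fun u hu => Real.toNNReal_le_toNNReal (h p hp u hu))

variable (near : β → ℕ → γ → ℕ → ℝ → Prop)

/-- **THE END's `hloc` FOR `ext := extsup`** splits into a READING fact and nothing else: if the nearness relation is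
monotone in the radius and every block of an admissibly placed zone is near the root cell AT ITS OWN WITNESS RADIUS
(`hnearW` — for a relation of distance form `near u t y s r := dist u t y s ≤ r` with `δ := dist` this is `le_rfl`; for the
torus touch relation it carries the reading's side conditions «`t ≤ K`, the root cell is a scale-`s` cell, the block is
in range»), then every such block is near the root cell at radius `extsup t Z`. [folklore] -/
theorem near_extsup (hmono : ∀ u t y s (r r' : ℝ), near u t y s r → r ≤ r' → near u t y s r')
    (hnearW : ∀ (t : ℕ) (Z : Gen ε) (p : Addr D → γ) (u : β), p ∈ Sany zone ρ c₀ st Z → u ∈ zone t Z p →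
      near u t (evalA c₀ p (rootAddr Z)) Z.rootStep (δ u t (evalA c₀ p (rootAddr Z)) Z.rootStep))
    (t : ℕ) (Z : Gen ε) (p : Addr D → γ) (u : β) (hp : p ∈ Sany zone ρ c₀ st Z) (hu : u ∈ zone t Z p) :
    near u t (evalA c₀ p (rootAddr Z)) Z.rootStep (extsup zone ρ c₀ st δ t Z) :=
  hmono _ _ _ _ _ _ (hnearW t Z p u hp hu) (le_extsup zone ρ c₀ st δ hp hu)

/-! ## §3 The count against the rank-free budget with the two local laws discharged -/

/-- **THE COUNT WITH `hcard`∕`hloc` DISCHARGED**: `#S G z ≤ budgetE st Msup extsup NZ G` — of the END's three local laws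
only the one-block root count `hNZ` stays a hypothesis (plus the reading fact `hnearW` and monotonicity of `near`).
[folklore] -/
theorem card_S_le_budgetE_sup (hmono : ∀ u t y s (r r' : ℝ), near u t y s r → r ≤ r' → near u t y s r')
    (hnearW : ∀ (t : ℕ) (Z : Gen ε) (p : Addr D → γ) (u : β), p ∈ Sany zone ρ c₀ st Z → u ∈ zone t Z p →
      near u t (evalA c₀ p (rootAddr Z)) Z.rootStep (δ u t (evalA c₀ p (rootAddr Z)) Z.rootStep))
    (NZ : ℝ → ℕ → ℕ → ℕ)
    (hNZ : ∀ (u : β) (t s : ℕ) (r : ℝ), (univ.filter fun y : γ => near u t y s r).card ≤ NZ r t s)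
    (G : Gen ε) (z : γ) :
    ((S zone ρ c₀ st G z).card : ℝ) ≤ budgetE st (Msup zone ρ c₀ st) (extsup zone ρ c₀ st δ) NZ G :=
  card_S_le_budgetE st (Msup zone ρ c₀ st) (extsup zone ρ c₀ st δ) NZ zone ρ c₀ near
    (fun t Z _ hp => card_zone_le_Msup zone ρ c₀ st t Z hp)
    (fun t Z p u hp hu => near_extsup zone ρ c₀ st δ near hmono hnearW t Z p u hp hu) hNZ G z

/-! ## §3b Nearness relations of INTEGER-RADIUS form (the torus touch relations) -/

section NatRadius

variable {near}
variable (touch : ℕ → β → ℕ → γ → ℕ → Prop)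

omit [DecidableEq β] in
/-- **THE REAL-RADIUS HULL OF AN INTEGER-RADIUS TOUCH RELATION**: `y` is near `u` at radius `r : ℝ` iff it touches at some
integer radius `k ≤ r` (for `HistoryMassPlacementTorus.touchT n L K k t u y s`-type relations). [folklore] -/
def nearOfNat : β → ℕ → γ → ℕ → ℝ → Prop := fun u t y s r => ∃ k : ℕ, (k : ℝ) ≤ r ∧ touch k u t y s

omit [DecidableEq β] [Fintype γ] in
/-- the hull is monotone in the radius (§2's `hmono`) [folklore] -/
theorem nearOfNat_mono (u : β) (t : ℕ) (y : γ) (s : ℕ) (r r' : ℝ) (h : nearOfNat touch u t y s r) (hr : r ≤ r') :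
    nearOfNat touch u t y s r' := by
  obtain ⟨k, hk, hky⟩ := h
  exact ⟨k, hk.trans hr, hky⟩

omit [DecidableEq β] [Fintype γ] in
/-- touching at integer radius `k` is being near at real radius `k` (§2's witness radius `δ := k`) [folklore] -/
theorem nearOfNat_of_touch {k : ℕ} {u : β} {t : ℕ} {y : γ} {s : ℕ} (h : touch k u t y s) :
    nearOfNat touch u t y s (k : ℝ) :=
  ⟨k, le_rfl, h⟩

omit [DecidableEq β] in
/-- **THE ONE-BLOCK COUNT TRANSFERS**: if the touch relation is monotone in its integer radius and `#{y | touch k u t y s}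
≤ N k t s` uniformly in the block `u`, then `#{y | nearOfNat touch u t y s r} ≤ N ⌊r⌋₊ t s` (§3's `hNZ` with
`NZ r t s := N ⌊r⌋₊ t s`; an empty set for `r < 0`). [folklore] -/
theorem card_nearOfNat_le (htmono : ∀ (k k' : ℕ) (u : β) (t : ℕ) (y : γ) (s : ℕ), k ≤ k' → touch k u t y s → touch k' u t y s)
    (N : ℕ → ℕ → ℕ → ℕ)
    (hN : ∀ (k : ℕ) (u : β) (t s : ℕ), (univ.filter fun y : γ => touch k u t y s).card ≤ N k t s)
    (u : β) (t s : ℕ) (r : ℝ) :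
    (univ.filter fun y : γ => nearOfNat touch u t y s r).card ≤ N ⌊r⌋₊ t s := by
  refine le_trans (card_le_card fun y hy => ?_) (hN ⌊r⌋₊ u t s)
  obtain ⟨k, hk, hky⟩ := (mem_filter.1 hy).2
  exact mem_filter.2 ⟨mem_univ _, htmono k _ u t y s (Nat.le_floor hk) hky⟩

end NatRadius

/-! ## §4 The mass-total input `hMS`: `MS` under a cardinality law displayed at the joins -/

omit [DecidableEq β] [LinearOrder R] [Fintype γ] in
/-- **`MS` UNDER A LAW AT THE JOINS**: if at every join `X ∈ joins st G` every part `P ∈ tparts st X` has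
`M (ftime X) P ≤ φ (ftime X) P`, then `MS st M G ≤ Σ_X Σ_P φ (ftime X) P` (`MS_eq_sum_joins`). [folklore] -/
theorem MS_le_of_law (M : ℕ → Gen ε → ℕ) (φ : ℕ → Gen ε → ℝ) (G : Gen ε)
    (hlaw : ∀ X ∈ joins st G, ∀ P ∈ tparts st X, (M (ftime st X) P : ℝ) ≤ φ (ftime st X) P) :
    MS st M G ≤ ((joins st G).map fun X => ((tparts st X).map fun P => φ (ftime st X) P).sum).sum := by
  rw [MS_eq_sum_joins]
  exact List.sum_le_sum fun X hX => List.sum_le_sum fun P hP => hlaw X hX P hP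

variable [DecidableEq ε] (sh : ε → PEv)

omit [DecidableEq β] [LinearOrder R] [Fintype γ] in
/-- **`MS ≤ umass∕(1−θ) + 2γ′·nmerges`** for a chronological, strictly dated shape tree under the cardinality law at the
joins in `zmass` currency (row (a)-TOTAL, `HistoryZoneMassTotal.sum_joins_tparts_zmass_add_le`). [folklore] -/
theorem MS_le_of_zmass (M : ℕ → Gen ε → ℕ) {θ WB WM γ' : ℝ} (hθ0 : 0 ≤ θ) (hθ1 : θ < 1) (hB : 0 ≤ WB)
    (hM : 0 ≤ WM) (hγ : 0 ≤ γ') {G : Gen ε} {T : ℕ} (hD : Dated (PEv.step ∘ sh) true T G)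
    (hC : Chrono (PEv.step ∘ sh) G)
    (hlaw : ∀ X ∈ joins (PEv.step ∘ sh) G, ∀ P ∈ tparts (PEv.step ∘ sh) X,
      (M (ftime (PEv.step ∘ sh) X) P : ℝ) ≤ zmass sh θ WB WM (ftime (PEv.step ∘ sh) X) P + γ') :
    MS (PEv.step ∘ sh) M G ≤ umass sh WB WM G / (1 - θ) + 2 * γ' * (nmerges G : ℝ) :=
  (MS_le_of_law (PEv.step ∘ sh) M (fun t P => zmass sh θ WB WM t P + γ') G hlaw).trans
    (sum_joins_tparts_zmass_add_le hθ0 hθ1 hB hM hγ hD hC)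

omit [DecidableEq β] [LinearOrder R] [Fintype γ] in
/-- **THE CONSUMER'S SHAPE `MS ≤ κM·F`**, `F = Σ_births (fat + 1)`, `κM = (WB + WM)∕(1 − θ) + 2γ′` — the END's first
class-linear input, discharged down to the cardinality law at the joins in `zmass` currency, `Chrono`, `Dated` and the
signs (`umass = WB·F + WM·nmerges`, `nmerges + 1 ≤ F`). [folklore] -/
theorem MS_le_bsum (M : ℕ → Gen ε → ℕ) {θ WB WM γ' : ℝ} (hθ0 : 0 ≤ θ) (hθ1 : θ < 1) (hB : 0 ≤ WB)
    (hM : 0 ≤ WM) (hγ : 0 ≤ γ') {G : Gen ε} {T : ℕ} (hD : Dated (PEv.step ∘ sh) true T G)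
    (hC : Chrono (PEv.step ∘ sh) G)
    (hlaw : ∀ X ∈ joins (PEv.step ∘ sh) G, ∀ P ∈ tparts (PEv.step ∘ sh) X,
      (M (ftime (PEv.step ∘ sh) X) P : ℝ) ≤ zmass sh θ WB WM (ftime (PEv.step ∘ sh) X) P + γ') :
    MS (PEv.step ∘ sh) M G ≤ ((WB + WM) / (1 - θ) + 2 * γ') * bsum (fun b => (((sh b).fat : ℕ) : ℝ) + 1) G := by
  refine (MS_le_of_zmass sh M hθ0 hθ1 hB hM hγ hD hC hlaw).trans ?_
  set F := bsum (fun b => (((sh b).fat : ℕ) : ℝ) + 1) G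
  have hn : (nmerges G : ℝ) + 1 ≤ F := nmerges_lt_bsum sh G
  have hn0 : (0 : ℝ) ≤ nmerges G := Nat.cast_nonneg _
  have hu : umass sh WB WM G = WB * F + WM * (nmerges G : ℝ) := by
    rw [umass_eq_bsum, ← bsum_mul]
  have h1θ : 0 < 1 - θ := by linarith
  have hum : umass sh WB WM G ≤ (WB + WM) * F := by rw [hu]; nlinarith
  have hdiv : umass sh WB WM G / (1 - θ) ≤ (WB + WM) / (1 - θ) * F := by
    rw [div_mul_eq_mul_div, div_le_div_iff_of_pos_right h1θ]; exact hum
  nlinarith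

/-- **THE CONSUMER'S SHAPE FOR `M := Msup`** under the PER-PLACEMENT cardinality law at the joins: every canonically
admissible junk placement `p` of a part `P` at a join `X` has `#zone (ftime X) P p ≤ zmass … (ftime X) P + γ′`. [folklore] -/
theorem MS_sup_le_bsum {θ WB WM γ' : ℝ} (hθ0 : 0 ≤ θ) (hθ1 : θ < 1) (hB : 0 ≤ WB) (hM : 0 ≤ WM) (hγ : 0 ≤ γ')
    {G : Gen ε} {T : ℕ} (hD : Dated (PEv.step ∘ sh) true T G) (hC : Chrono (PEv.step ∘ sh) G)
    (hlawM : ∀ X ∈ joins (PEv.step ∘ sh) G, ∀ P ∈ tparts (PEv.step ∘ sh) X,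
      ∀ p ∈ Sany zone ρ c₀ (PEv.step ∘ sh) P,
        ((zone (ftime (PEv.step ∘ sh) X) P p).card : ℝ) ≤ zmass sh θ WB WM (ftime (PEv.step ∘ sh) X) P + γ') :
    MS (PEv.step ∘ sh) (Msup zone ρ c₀ (PEv.step ∘ sh)) G ≤
      ((WB + WM) / (1 - θ) + 2 * γ') * bsum (fun b => (((sh b).fat : ℕ) : ℝ) + 1) G :=
  MS_le_bsum sh (Msup zone ρ c₀ (PEv.step ∘ sh)) hθ0 hθ1 hB hM hγ hD hC fun X hX P hP =>
    Msup_le_of_forall zone ρ c₀ (PEv.step ∘ sh)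
      (add_nonneg (zmass_nonneg (sh := sh) hθ0 hB hM _ P) hγ) (hlawM X hX P hP)

/-! ## §5 The radius-factor input `hMρP` on `extsup`: the extent law per placement at the joins -/

/-- **THE CONSUMER'S SHAPE `MρP ≤ exp(κρ·F)` FOR `ext := extsup`**, `κρ = 2(a + d·c₁) + d·C₁·(WB + WM)∕(1 − θ)` — leaf-05
gen 2's `HistoryJoinsRadius.MρP_le_exp_bsum` with its extent law discharged to the PER-PLACEMENT extent law at the joins:
every block `u` of the zone of an admissibly placed part `P` at a join `X` has witness radius
`δ u (ftime X) (root cell) (rootStep P) ≤ C₁·zmass … (ftime X) P + c₁`. [folklore] -/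
theorem MρP_sup_le_exp_bsum (Mρ : ℝ → ℝ) {a d : ℝ} (ha : 0 ≤ a) (hd : 0 ≤ d) (hMρ0 : ∀ r, 0 ≤ Mρ r)
    (hMρ : ∀ r, 0 ≤ r → Mρ r ≤ Real.exp (a + d * r)) {C₁ c₁ : ℝ} (hC₁ : 0 ≤ C₁) (hc₁ : 0 ≤ c₁)
    {θ WB WM : ℝ} (hθ0 : 0 ≤ θ) (hθ1 : θ < 1) (hB : 0 ≤ WB) (hM : 0 ≤ WM)
    {G : Gen ε} {T : ℕ} (hD : Dated (PEv.step ∘ sh) true T G) (hC : Chrono (PEv.step ∘ sh) G)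
    (hlawE : ∀ X ∈ joins (PEv.step ∘ sh) G, ∀ P ∈ tparts (PEv.step ∘ sh) X,
      ∀ p ∈ Sany zone ρ c₀ (PEv.step ∘ sh) P, ∀ u ∈ zone (ftime (PEv.step ∘ sh) X) P p,
        δ u (ftime (PEv.step ∘ sh) X) (evalA c₀ p (rootAddr P)) P.rootStep ≤
          C₁ * zmass sh θ WB WM (ftime (PEv.step ∘ sh) X) P + c₁) :
    MρP (PEv.step ∘ sh) (extsup zone ρ c₀ (PEv.step ∘ sh) δ) Mρ G ≤
      Real.exp ((2 * (a + d * c₁) + d * C₁ * ((WB + WM) / (1 - θ))) * bsum (fun b => (((sh b).fat : ℕ) : ℝ) + 1) G) :=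
  MρP_le_exp_bsum Mρ sh ha hd hMρ0 hMρ (fun t P => extsup_nonneg zone ρ c₀ (PEv.step ∘ sh) δ t P) hC₁ hc₁ hθ0 hθ1
    hB hM hD hC fun X hX P hP =>
      extsup_le_of_forall zone ρ c₀ (PEv.step ∘ sh) δ
        (add_nonneg (mul_nonneg hC₁ (zmass_nonneg (sh := sh) hθ0 hB hM _ P)) hc₁) (hlawE X hX P hP)


/-! ## §6 Sanity: the two shapes of `near` the instance meets -/

namespace Sanity

/-- DISTANCE FORM: for `near u t y s r := dist u t y s ≤ r` with witness radius `δ := dist`, §2's reading fact `hnearW`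
is `le_rfl` at every argument … -/
example (dist : β → ℕ → γ → ℕ → ℝ) (u : β) (t : ℕ) (y : γ) (s : ℕ) :
    (fun u t y s (r : ℝ) => dist u t y s ≤ r) u t y s (dist u t y s) :=
  le_rfl

/-- … and monotonicity `hmono` is transitivity of `≤` -/
example (dist : β → ℕ → γ → ℕ → ℝ) (u : β) (t : ℕ) (y : γ) (s : ℕ) (r r' : ℝ)
    (h : (fun u t y s (r : ℝ) => dist u t y s ≤ r) u t y s r) (hr : r ≤ r') :
    (fun u t y s (r : ℝ) => dist u t y s ≤ r) u t y s r' :=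
  le_trans h hr

/-- INTEGER-RADIUS FORM: a toy touch relation on `Fin 5` («`y ≤ k`», monotone in `k`) counted by `N k t s := k + 1`
uniformly; the hull's count at real radius `5∕2` is at most `N ⌊5∕2⌋₊ t s` by `card_nearOfNat_le` -/
example (u : Unit) (t s : ℕ) :
    ((univ : Finset (Fin 5)).filter fun y => nearOfNat (fun k (_ : Unit) (_ : ℕ) (y : Fin 5) (_ : ℕ) => y.val ≤ k)
      u t y s ((5 : ℝ) / 2)).card ≤ ⌊(5 : ℝ) / 2⌋₊ + 1 := by
  refine card_nearOfNat_le (fun k (_ : Unit) (_ : ℕ) (y : Fin 5) (_ : ℕ) => y.val ≤ k)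
    (fun k k' _ _ y _ hk h => le_trans h hk) (fun k _ _ => k + 1) (fun k _ _ _ => ?_) u t s _
  refine (card_le_card_of_injOn (fun y : Fin 5 => y.val) (fun y hy => ?_)
    (Set.injOn_of_injective Fin.val_injective)).trans (card_range (k + 1)).le
  simp only [Finset.coe_filter, mem_univ, true_and, Set.mem_setOf_eq] at hy
  exact Finset.mem_coe.2 (mem_range.2 (Nat.lt_succ_of_le hy))

end Sanity

end

end Summit.QuantumFields.BalabanUV.T4Continuum.HistoryJoinsSup
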